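import Mathlib

/-!
# SoloBlind kernel #79 — the sign of the near window root (algebraic core of the upstream contact law)

Leaf-level algebra behind the UPSTREAM LAW of the steady door (solo-blind paper §24.21(3)U, claim SB-C412).
Just inside the upstream band edge a steady pattern is nearly empty, so a supercritical leaf (`S > 0`, written
here as `G < 0` for the window constant `G = g q - S - s₀ u`) is marginal only if its shear `μ` is a root of the
quadratic window `κ μ² - b μ + G = 0` (`κ > 0`).  With `G < 0` the two roots `r`, `s` have opposite signs
(`r s = G/κ < 0`); the pattern selects the NEAR root (the one of smaller modulus, continuous with `μ = 0` at the
bare edge).  The facts used by the law: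

* `near_root_mul_sum_neg` : if `r s < 0` and `|r| < |s|` then `r (r + s) < 0` — the near root has the sign
  opposite to the sum of the roots, i.e. opposite to `b` (`r + s = b/κ`);
* `near_root_shear_sign` : under Vieta's relations for `κ μ² - b μ + G` with `κ > 0`, `G < 0`, the near root
  satisfies `b r < 0` (the tune term `b μ` is STABILISING on the upstream foot);
* `liftoff_sign` : with the kinematic law `q‴ = -r/A`, `A = P₄/c_H > 0`, the lift-off curvature growth
  `-r/A` has the sign of `b`: `0 < b (-r/A)`.  Hence a positive (admissible) lift-off at the upstream edge
  requires `b > 0` there — the sign law `sign b = sign (P₄/c_H)` of §24.21.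
-/

namespace Summit.AnomalousDissipation.AnomalousDissipation.Theorems

/-- If two reals have opposite signs and `r` is the one of smaller modulus, then `r` has the sign opposite
to their sum. -/
theorem near_root_mul_sum_neg (r s : ℝ) (hrs : r * s < 0) (h : |r| < |s|) : r * (r + s) < 0 := by
  have hr : r ≠ 0 := by
    intro h0; rw [h0, zero_mul] at hrs; exact lt_irrefl 0 hrs
  have hrabs : 0 < |r| := abs_pos.mpr hr
  -- r (r + s) = r² + r s = |r|² - |r||s| since r s < 0
  have h1 : r * s = -(|r| * |s|) := by
    rw [← abs_mul]; have := abs_of_neg hrs; linarith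
  have h2 : r * r = |r| * |r| := by rw [← abs_mul_abs_self r]
  have h3 : |r| * |r| < |r| * |s| := mul_lt_mul_of_pos_left h hrabs
  calc r * (r + s) = r * r + r * s := by ring
    _ = |r| * |r| - |r| * |s| := by rw [h2, h1]; ring
    _ < 0 := by linarith

/-- Vieta form: for the window `κ μ² - b μ + G` with `κ > 0` and `G < 0` (supercritical, nearly empty leaf),
roots `r`, `s` with `r + s = b/κ`, `r s = G/κ`, the near root `r` (`|r| < |s|`) makes the tune term
stabilising: `b r < 0`. -/
theorem near_root_shear_sign (κ b G r s : ℝ) (hκ : 0 < κ) (hG : G < 0)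
    (hsum : r + s = b / κ) (hprod : r * s = G / κ) (hnear : |r| < |s|) : b * r < 0 := by
  have hrs : r * s < 0 := by rw [hprod]; exact div_neg_of_neg_of_pos hG hκ
  have h := near_root_mul_sum_neg r s hrs hnear
  rw [hsum] at h
  -- h : r * (b / κ) < 0
  have hk : r * (b / κ) = (b * r) / κ := by ring
  rw [hk] at h
  by_contra hcon
  have hcon' : 0 ≤ b * r := not_lt.mp hcon
  have : 0 ≤ b * r / κ := div_nonneg hcon' hκ.le
  linarith

/-- Lift-off sign: with the kinematic outer law `q‴ = -r/A`, `A > 0`, the lift-off `-r/A` has the sign of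
`b`.  In particular an admissible (positive) lift-off at the upstream edge forces `b > 0`. -/
theorem liftoff_sign (κ b G r s A : ℝ) (hκ : 0 < κ) (hG : G < 0) (hA : 0 < A)
    (hsum : r + s = b / κ) (hprod : r * s = G / κ) (hnear : |r| < |s|) : 0 < b * (-r / A) := by
  have h := near_root_shear_sign κ b G r s hκ hG hsum hprod hnear
  have : b * (-r / A) = -(b * r) / A := by ring
  rw [this]
  exact div_pos (by linarith) hA

/-- Corollary used verbatim by the upstream law: if the lift-off is positive (`0 < -r/A`) then `0 < b`. -/
theorem upstream_sign_law (κ b G r s A : ℝ) (hκ : 0 < κ) (hG : G < 0) (hA : 0 < A)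
    (hsum : r + s = b / κ) (hprod : r * s = G / κ) (hnear : |r| < |s|) (hlift : 0 < -r / A) : 0 < b := by
  have h := liftoff_sign κ b G r s A hκ hG hA hsum hprod hnear
  by_contra hb
  have hb' : b ≤ 0 := not_lt.mp hb
  have : b * (-r / A) ≤ 0 := mul_nonpos_of_nonpos_of_nonneg hb' hlift.le
  linarith

end Summit.AnomalousDissipation.AnomalousDissipation.Theorems
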